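import Summits.MatrixMultiplication.MatrixMultiplication.Theorems.SoloInformedCornerDoor
import Mathlib.Analysis.Complex.Polynomial.Basic
import Mathlib.Algebra.QuadraticDiscriminant

/-!
# The family door is unconditional: `R̃(T_{1,1,M}) = 3 ⇒ ω = 2` for EVERY non-degenerate block

Solo deliverable (informed mode), the last step of the carrier-family programme
(`SoloInformedCarrierFamily` → `WeightedLaser` → `GammaDoor` → `CornerDoor`). In
`SoloInformedCarrierFamily` the door for a general Coppersmith–Winograd-shaped carrier was
conditional on the named fact `hBCS` (BCS Thm. (15.41) + Ex. 15.24(7)); here it becomes a plain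
theorem for every block-normal carrier `T_{1,1,M}`, `det M′ ≠ 0`, WITHOUT classifying congruence
classes of bilinear forms:

* `cwShapeTensor_restrictsTo_shear`: the basis change `(1 ⊕ X, 1 ⊕ X, 1 ⊕ X⁻ᵀ)`,
  `X = [[1,x],[0,1]]`, maps `T_{1,1,M}` onto `T_{1,1,XᵀMX}` (identity blocks preserved, `c₀`-block sheared).
* `laserBound_blockNormal`: if `M′₁₁ = 0` the block is a zero-corner block (`det ≠ 0` forces
  `M′₁₂M′₂₁ ≠ 0`) and `CornerDoor` applies; otherwise choose a root `x` of the quadratic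
  `M′₁₁x² + (M′₁₂+M′₂₁)x + M′₂₂` (`ℂ` is algebraically closed): the sheared block has `(2,2)`-entry
  `0` and — because `det M′ ≠ 0` — non-zero off-diagonal entries, so `CornerDoor` applies to it and
  `R̃(T_{1,1,XᵀMX}) ≤ R̃(T_{1,1,M})` transports the bound.
* `matrixMultiplication_of_blockNormal_door`: **`det M′ ≠ 0 ⇒ (R̃(T_{1,1,M}) ≤ 3 ⇒ ω(ℂ) = 2)`**,
  with the uniform width `R̃ ≤ 3.25 ⇒ ω < 2.37` and the uniform floor `3 ≤ R̃(T_{1,1,M})`.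
-/

noncomputable section

open scoped BigOperators Polynomial
open Polynomial
open Literature.Computability.AlgebraicComplexity

namespace Summit.MatrixMultiplication.MatrixMultiplication.Theorems.CarrierFamily

/-! ## Completing the square: every non-degenerate block reduces to a zero-corner block -/

/-- The inner-block shear `M′ ↦ Xᵀ M′ X`, `X = [[1, x], [0, 1]]` (row and column `0` zeroed, which
`cwShapeTensor 1 1 ·` ignores). [folklore] -/
def shearBlock (x : ℂ) (M : Matrix (Fin 3) (Fin 3) ℂ) : Matrix (Fin 3) (Fin 3) ℂ := fun i j =>
  if i = 1 ∧ j = 1 then M 1 1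
  else if i = 1 ∧ j = 2 then M 1 1 * x + M 1 2
  else if i = 2 ∧ j = 1 then M 1 1 * x + M 2 1
  else if i = 2 ∧ j = 2 then M 1 1 * x ^ 2 + (M 1 2 + M 2 1) * x + M 2 2
  else 0

/-- `Y = 1 ⊕ X` (acts on the `a`- and `b`-factors). [folklore] -/
def shearY (x : ℂ) : Matrix (Fin 3) (Fin 3) ℂ := ![![1, 0, 0], ![0, 1, x], ![0, 0, 1]]

/-- `Z = 1 ⊕ X⁻ᵀ` (acts on the `c`-factor). [folklore] -/
def shearZ (x : ℂ) : Matrix (Fin 3) (Fin 3) ℂ := ![![1, 0, 0], ![0, 1, 0], ![0, -x, 1]]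

/-- Entries of the sheared block. [folklore] -/
theorem shearBlock_entries (x : ℂ) (M : Matrix (Fin 3) (Fin 3) ℂ) :
    shearBlock x M 1 1 = M 1 1 ∧ shearBlock x M 1 2 = M 1 1 * x + M 1 2 ∧
      shearBlock x M 2 1 = M 1 1 * x + M 2 1 ∧
      shearBlock x M 2 2 = M 1 1 * x ^ 2 + (M 1 2 + M 2 1) * x + M 2 2 := by
  simp [shearBlock]

/-- **`T_{1,1,M} ≥ T_{1,1,XᵀMX}`**: the basis change `(1 ⊕ X, 1 ⊕ X, 1 ⊕ X⁻ᵀ)` preserves the two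
identity blocks and shears the `c₀`-block (an isomorphism; one direction suffices here).
[cite: BurgisserClausenShokrollahi1997, (14.24)] -/
theorem cwShapeTensor_restrictsTo_shear (M : Matrix (Fin 3) (Fin 3) ℂ) (x : ℂ) :
    TensorRestrictsTo (cwShapeTensor 1 1 M) (cwShapeTensor 1 1 (shearBlock x M)) := by
  refine ⟨fun a' a => shearY x a a', fun b' b => shearY x b b', fun c' c => shearZ x c c',
    fun a' b' c' => ?_⟩
  fin_cases a' <;> fin_cases b' <;> fin_cases c' <;>
    simp [Fin.sum_univ_three, cwShapeTensor, shearBlock, shearY, shearZ] <;> ring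

/-- `R̃(T_{1,1,XᵀMX}) ≤ R̃(T_{1,1,M})`. [folklore] -/
theorem asymptoticRank_shear_le (M : Matrix (Fin 3) (Fin 3) ℂ) (x : ℂ) :
    asymptoticRank (cwShapeTensor 1 1 (shearBlock x M)) ≤ asymptoticRank (cwShapeTensor 1 1 M) :=
  asymptoticRank_le_of_algDegeneratesTo (cwShapeTensor_restrictsTo_shear M x).algDegeneratesTo

/-- **Value bound for EVERY block-normal carrier, unconditionally**: `det M′ ≠ 0 ⇒
(R̃(T_{1,1,M}) < ρ ⇒ ω ≤ log₂(4ρ³/27))`. If `M′₁₁ = 0` this is the zero-corner case; otherwise a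
root `x` of `M′₁₁ x² + (M′₁₂ + M′₂₁) x + M′₂₂` (which exists over `ℂ`) shears `M′` to a block with
`(2,2)`-entry `0`, whose off-diagonal entries cannot vanish since `det M′ ≠ 0` — no classification
of congruence classes is used. [cite: BurgisserClausenShokrollahi1997, Thm. (15.41), Ex. 15.24(7)] -/
theorem laserBound_blockNormal {M : Matrix (Fin 3) (Fin 3) ℂ} (hdet : (innerBlock M).det ≠ 0)
    (ρ : ℝ) (hρ : asymptoticRank (cwShapeTensor 1 1 M) < ρ) :
    omega ℂ ≤ Real.logb 2 (4 * ρ ^ 3 / 27) := by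
  rw [det_innerBlock] at hdet
  by_cases h11 : M 1 1 = 0
  · have h12 : M 1 2 ≠ 0 := by
      intro h; apply hdet; rw [h11, h]; ring
    have h21 : M 2 1 ≠ 0 := by
      intro h; apply hdet; rw [h11, h]; ring
    exact laserBound_cornerBlock h12 h21 (Or.inl h11) ρ hρ
  · obtain ⟨x, hx⟩ := exists_quadratic_eq_zero h11
      (IsAlgClosed.exists_eq_mul_self (discrim (M 1 1) (M 1 2 + M 2 1) (M 2 2)))
    obtain ⟨-, e12, e21, e22⟩ := shearBlock_entries x M
    refine laserBound_cornerBlock (M := shearBlock x M) ?_ ?_ (Or.inr ?_) ρ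
      ((asymptoticRank_shear_le M x).trans_lt hρ)
    · rw [e12]
      intro h; apply hdet; linear_combination (M 1 1) * hx - (M 1 1 * x + M 2 1) * h
    · rw [e21]
      intro h; apply hdet; linear_combination (M 1 1) * hx - (M 1 1 * x + M 1 2) * h
    · rw [e22]
      linear_combination hx

/-- **THE FAMILY DOOR, UNCONDITIONAL** (block-normal form): for every `M` with non-degenerate
inner block, `R̃(T_{1,1,M}) ≤ 3 ⇒ ω(ℂ) = 2` — a theorem with no hypothesis, for a two-parameter
family (three congruence classes) of pairwise non-isomorphic `3 × 3 × 3` carriers.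
[cite: CoppersmithWinograd1990, §6] [cite: ConnerGesmundoLandsbergVentura2022, §5] -/
theorem matrixMultiplication_of_blockNormal_door {M : Matrix (Fin 3) (Fin 3) ℂ}
    (hdet : (innerBlock M).det ≠ 0) (h : asymptoticRank (cwShapeTensor 1 1 M) ≤ 3) :
    _root_.MatrixMultiplication :=
  matrixMultiplication_of_laserBound (laserBound_blockNormal hdet) h

/-- Width, uniformly over the family: `det M′ ≠ 0`, `R̃(T_{1,1,M}) ≤ 3.25 ⇒ ω < 2.37`.
[cite: AlmanDuanVassilevskaWilliamsXuXuZhou2025, Theorem 1.1] -/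
theorem omega_lt_of_asymptoticRank_blockNormal_le {M : Matrix (Fin 3) (Fin 3) ℂ}
    (hdet : (innerBlock M).det ≠ 0) (h : asymptoticRank (cwShapeTensor 1 1 M) ≤ 3.25) :
    omega ℂ < 2.37 := by
  have hρ : asymptoticRank (cwShapeTensor 1 1 M) < 3.26 := lt_of_le_of_lt h (by norm_num)
  exact (laserBound_blockNormal hdet _ hρ).trans_lt WeightedLaser.logb_two_laser_bound_lt

/-- The kernel window of every block-normal carrier contains the door value at its left end:
`3 ≤ R̃(T_{1,1,M})` (flattening) — so the door asks for EQUALITY `R̃ = 3`. [folklore] -/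
theorem three_le_asymptoticRank_blockNormal {M : Matrix (Fin 3) (Fin 3) ℂ} :
    (3 : ℝ) ≤ asymptoticRank (cwShapeTensor 1 1 M) :=
  three_le_asymptoticRank_cwShapeTensor (by simp [innerBlock_one]) (by simp [innerBlock_one])

end Summit.MatrixMultiplication.MatrixMultiplication.Theorems.CarrierFamily

end
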